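import Mathlib
import HarnessLib
import Literature.MathematicalPhysics.StatisticalMechanics.LinearisedMapLargePart
import Literature.MathematicalPhysics.StatisticalMechanics.PolymerExpansion
import Literature.MathematicalPhysics.StatisticalMechanics.WeightedNormBounds

/-!
# The polynomial map `P₂(I,K) = (I−1) ∘ K` of [ABKM19] Lemma 9.4: the zeroth-order norm bound
# `|((F^∘) ∘ K)(X)|_{T_φ} ≤ Σ_{Y ⊆ X} (∏_{B ∈ 𝓑(X∖Y)} a_B) c_Y · w^X(φ)`

[ABKM19] (9.18)–(9.19): for a block functional `F` (in the source `F = I − 1 = e^{−H} − 1`) bounded in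
the strong norm, `|F(B)|_{T_φ} ≤ a · W^B(φ)`, and a polymer activity `K` with `|K(Y)|_{T_φ} ≤ c_Y w^Y(φ)`
(`c_Y = ‖K‖^{|𝒞(Y)|} A^{−|Y|}` after Lemma 8.3 (i)), the circle product
`P₂(F,K)(X) = Σ_{Y ∈ 𝓟(X)} F^{X∖Y} K(Y)` satisfies
`|P₂(F,K)(X)|_{k,X,T_φ} ≤ Σ_{Y} a^{|X∖Y|_k} c_Y · w^X(φ)` by submultiplicativity of the Taylor norms
(`TayNormLE.prod`, `TayNormLE.mul`) and the weight inequality `W^{X∖Y} w^Y ≤ w^X` ((w5), Lemma 7.6 (ii),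
the tree's `WeightData.weight_mul_strongWeight_le`).  This file proves that estimate ABSTRACTLY (any
gauge `T` dominating the block and polymer gauges, any weights with the combination inequality), the
form consumed by the Lemma 9.4/9.6 estimates:

* **`tayNormLE_bprod`** — `|F^Z|_{T_φ} ≤ (∏_{B∈𝓑(Z)} a_B) · ∏_B W^B(φ)`;
* **`tayNormLE_sum_bprod_mul`** — the bound on `Σ_Y F^{X∖Y} K(Y)` displayed above (the source's
  `(F^∘ ∘ K)(X)`; `pcirc_comm` on polymers).

Everything is proved; no named fact.

## References
* S. Adams, S. Buchholz, R. Kotecký, S. Müller, arXiv:1910.13564, Lemma 9.4 ((9.18)–(9.19)),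
  Lemma 8.3 [AdamsBuchholzKoteckyMuller2019].
-/

noncomputable section

namespace Literature.MathematicalPhysics.StatisticalMechanics.GradientRG

open scoped BigOperators Classical
open Finset
open Literature.MathematicalPhysics.StatisticalMechanics.TorusPolymer (IsPolymer blocks polys pcirc bprod mem_polys)
open Literature.MathematicalPhysics.QuantumFieldTheory

variable {d M : ℕ} [NeZero M]
  {V : Type*} [NormedAddCommGroup V] [NormedSpace ℝ V]
  {Vb : Finset (Fin d → ZMod M) → Type*} [∀ B, NormedAddCommGroup (Vb B)] [∀ B, NormedSpace ℝ (Vb B)]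

/-- Locality for a smaller gauge implies locality for a dominating gauge.
[cite: AdamsBuchholzKoteckyMuller2019, Lemma 8.2] -/
theorem IsGaugeLocal.of_norm_le {U : Type*} [NormedAddCommGroup U] [NormedSpace ℝ U]
    {T : ((Fin d → ZMod M) → ℝ) →ₗ[ℝ] V} {T₁ : ((Fin d → ZMod M) → ℝ) →ₗ[ℝ] U} {𝔸 : Type*}
    {F : ((Fin d → ZMod M) → ℝ) → 𝔸} (hF : IsGaugeLocal T₁ F) (hle : ∀ ξ, ‖T₁ ξ‖ ≤ ‖T ξ‖) :
    IsGaugeLocal T F := by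
  intro φ ψ h
  apply hF
  have h0 : ‖T₁ (φ - ψ)‖ ≤ ‖T (φ - ψ)‖ := hle _
  rw [map_sub T, h, sub_self, norm_zero] at h0
  rw [← sub_eq_zero, ← map_sub]
  exact norm_le_zero_iff.1 h0

/-- **`|F^Z|_{T_φ} ≤ (∏_{B ∈ 𝓑_k(Z)} a_B) ∏_{B ∈ 𝓑_k(Z)} W^B(φ)`** for block functionals with
`|F(B)|_{T_B, W^B} ≤ a_B` (`a_B ≥ 0`), block gauges `T_B` dominated by `T`.
[cite: AdamsBuchholzKoteckyMuller2019, Lemma 8.3 (ii)] -/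
theorem tayNormLE_bprod (s : ℕ) (T : ((Fin d → ZMod M) → ℝ) →ₗ[ℝ] V)
    (Tb : ∀ B : Finset (Fin d → ZMod M), ((Fin d → ZMod M) → ℝ) →ₗ[ℝ] Vb B) {r₀ : ℕ}
    {W : Finset (Fin d → ZMod M) → ((Fin d → ZMod M) → ℝ) → ℝ}
    {F : Finset (Fin d → ZMod M) → ((Fin d → ZMod M) → ℝ) → ℂ} {a : Finset (Fin d → ZMod M) → ℝ}
    (Z : Finset (Fin d → ZMod M))
    (hF : ∀ B ∈ blocks s Z, TayNormLE (Tb B) r₀ (W B) (F B) (a B))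
    (hle : ∀ B ∈ blocks s Z, ∀ ξ, ‖Tb B ξ‖ ≤ ‖T ξ‖)
    (hFd : ∀ B ∈ blocks s Z, ContDiff ℝ r₀ (F B))
    (hFloc : ∀ B ∈ blocks s Z, IsGaugeLocal (Tb B) (F B)) (ha : ∀ B ∈ blocks s Z, 0 ≤ a B) :
    TayNormLE T r₀ (fun φ => ∏ B ∈ blocks s Z, W B φ) (fun φ => bprod s (fun B => F B φ) Z)
      (∏ B ∈ blocks s Z, a B) :=
  TayNormLE.prod (T := T) (r₀ := r₀) (w := fun φ => ∏ B ∈ blocks s Z, W B φ)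
    (Ti := fun B => Tb B) (wi := fun B => W B) (Ki := fun B => F B) (Ci := a) (blocks s Z)
    hF hle hFd hFloc ha (fun _ => le_rfl)

/-- **The zeroth-order bound on `P₂(F,K)(X) = Σ_{Y ∈ 𝓟_k(X)} F^{X∖Y}(φ) K(Y, φ)`** ([ABKM19] (9.19)):
with `|F(B)|_{T_B,W^B} ≤ a_B`, `|K(Y)|_{T_Y,w^Y} ≤ c_Y` for the polymers `Y ⊆ X` (`a, c ≥ 0`), gauges
dominated by `T`, and the weight inequality `(∏_{B∈𝓑(X∖Y)} W^B) · w^Y ≤ w` for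
every `Y ∈ 𝓟_k(X)` ((w5)): `|Σ_Y F^{X∖Y} K(Y)|_{T, w} ≤ Σ_{Y ∈ 𝓟_k(X)} (∏_{B ∈ 𝓑(X∖Y)} a_B) c_Y`.
(The source's `(F^∘ ∘ K)(X) = pcirc s (F^∘) K X` sums `F^Y K(X∖Y)`; by `pcirc_comm` on polymers it is
the same sum.) [cite: AdamsBuchholzKoteckyMuller2019, Lemma 9.4 (9.19)] -/
theorem tayNormLE_sum_bprod_mul (s : ℕ) (T : ((Fin d → ZMod M) → ℝ) →ₗ[ℝ] V)
    (Tb : ∀ B : Finset (Fin d → ZMod M), ((Fin d → ZMod M) → ℝ) →ₗ[ℝ] Vb B)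
    {Vp : Finset (Fin d → ZMod M) → Type*} [∀ Y, NormedAddCommGroup (Vp Y)] [∀ Y, NormedSpace ℝ (Vp Y)]
    (Tp : ∀ Y : Finset (Fin d → ZMod M), ((Fin d → ZMod M) → ℝ) →ₗ[ℝ] Vp Y) {r₀ : ℕ}
    {W wp : Finset (Fin d → ZMod M) → ((Fin d → ZMod M) → ℝ) → ℝ} {w : ((Fin d → ZMod M) → ℝ) → ℝ}
    {F K : Finset (Fin d → ZMod M) → ((Fin d → ZMod M) → ℝ) → ℂ}
    {a c : Finset (Fin d → ZMod M) → ℝ} (X : Finset (Fin d → ZMod M))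
    (hF : ∀ B ∈ blocks s X, TayNormLE (Tb B) r₀ (W B) (F B) (a B))
    (hleb : ∀ B ∈ blocks s X, ∀ ξ, ‖Tb B ξ‖ ≤ ‖T ξ‖)
    (hFd : ∀ B ∈ blocks s X, ContDiff ℝ r₀ (F B))
    (hFloc : ∀ B ∈ blocks s X, IsGaugeLocal (Tb B) (F B)) (ha : ∀ B ∈ blocks s X, 0 ≤ a B)
    (hK : ∀ Y ∈ polys s X, TayNormLE (Tp Y) r₀ (wp Y) (K Y) (c Y))
    (hlep : ∀ Y ∈ polys s X, ∀ ξ, ‖Tp Y ξ‖ ≤ ‖T ξ‖)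
    (hKd : ∀ Y ∈ polys s X, ContDiff ℝ r₀ (K Y))
    (hKloc : ∀ Y ∈ polys s X, IsGaugeLocal (Tp Y) (K Y)) (hc : ∀ Y ∈ polys s X, 0 ≤ c Y)
    (hw : ∀ Y ∈ polys s X, ∀ φ, (∏ B ∈ blocks s (X \ Y), W B φ) * wp Y φ ≤ w φ) :
    TayNormLE T r₀ w (fun φ => ∑ Y ∈ polys s X, bprod s (fun B => F B φ) (X \ Y) * K Y φ)
      (∑ Y ∈ polys s X, (∏ B ∈ blocks s (X \ Y), a B) * c Y) := by
  have hterm : ∀ Y ∈ polys s X, TayNormLE T r₀ w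
      (fun φ => bprod s (fun B => F B φ) (X \ Y) * K Y φ) ((∏ B ∈ blocks s (X \ Y), a B) * c Y) := by
    intro Y hY
    have hsub : blocks s (X \ Y) ⊆ blocks s X := TorusPolymer.blocks_mono s sdiff_subset
    have h1 := tayNormLE_bprod s T Tb (X \ Y) (fun B hB => hF B (hsub hB)) (fun B hB => hleb B (hsub hB))
      (fun B hB => hFd B (hsub hB)) (fun B hB => hFloc B (hsub hB)) (fun B hB => ha B (hsub hB))
    have hprodCD : ContDiff ℝ r₀ (fun φ => bprod s (fun B => F B φ) (X \ Y)) := by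
      unfold TorusPolymer.bprod
      exact contDiff_prod fun B hB => hFd B (hsub hB)
    have hprodloc : IsGaugeLocal T (fun φ => bprod s (fun B => F B φ) (X \ Y)) := by
      unfold TorusPolymer.bprod
      exact IsGaugeLocal.prod _ fun B hB => (hFloc B (hsub hB)).of_norm_le (hleb B (hsub hB))
    have h2 := TayNormLE.mul (T := T) (w := w) h1 (hK Y hY) (fun ξ => le_rfl) (hlep Y hY) hprodCD (hKd Y hY)
      hprodloc (hKloc Y hY) (Finset.prod_nonneg fun B hB => ha B (hsub hB)) (hc Y hY) (hw Y hY)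
    exact h2
  have h := TayNormLE.sum (T := T) (r₀ := r₀) (w := w) (polys s X) hterm fun Y hY => by
    have hsub : blocks s (X \ Y) ⊆ blocks s X := TorusPolymer.blocks_mono s sdiff_subset
    have hprodCD : ContDiff ℝ r₀ (fun φ => bprod s (fun B => F B φ) (X \ Y)) := by
      unfold TorusPolymer.bprod
      exact contDiff_prod fun B hB => hFd B (hsub hB)
    exact hprodCD.mul (hKd Y hY)
  exact h

end Literature.MathematicalPhysics.StatisticalMechanics.GradientRG

end
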